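import Summits.Ventures.Crystal3D.Theorems.StickyWulffConstantNoReconstructionGainWKNoGo
import HarnessLib

/-!
# Height-confined `(111)` films — the windowed weighted-kissing bound `ConfinedCodeBound` (definitions;
# line `replication-exactness`, inside `stub_noCriminal`)

HONEST FRAMING. Part of the venture `Summits/Ventures/Crystal3D` (cell `crystal3d-full`), helper `--supports` the
crux `NoReconstructionGain` (stmt-Ventures-19144, route `route-Ventures-StickyWulffConstant`), lead wulff-p1 g20.
DEFINITIONS (one named `Prop` shape) plus two remarks about it; nothing about films is proved here — the reduction
«`ConfinedCodeBound W g` ⟹ no height-`W`-confined `(111)` criminal» is the sequel `…ConfinedCertificate`.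

The pointwise "weighted kissing" method (a height profile `g`, every bond `q'—q` charged `g(h_{q'} − h_q)/2` to
`q`, every substrate plug charged `1`) is killed on UNCONFINED films by the certified no-go
`WKNoGo.weightedKissing_noGo_ten` (ten-point codes of vertical extent `≈ 1.55`; any eleven-ball cluster may float
above the face).  What survives is the CONFINED case: if every ball of a film over the close-packed layer `k` of
`Λ₀` lies at height `≤ (k+1)√(2/3) + W`, the full neighbour code of a ball at height `h` (directions to film
partners AND to substrate plugs) is a `60°`-code whose members sit either at third coordinate exactly `a − √(2/3)`
(plugs; `a := (k+1)√(2/3) − h ≤ 0`) or in the window `[a, a + W]` (film partners).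

* `ConfinedCodeBound W g` — NAMED SHAPE (nothing asserted): for every offset `a` and every finite `60°`-code `N` of
  unit vectors with each member at third coordinate `a − √(2/3)` or in `[a, a + W]`, `Σ_{u ∈ N} g(u₂) ≤ 12`;
* `ConfinedCodeBound.mono` — antitone in the window;
* `not_confinedCodeBound_two` — with `W = 2` (no confinement) the bound is FALSE for every antitone `g` with
  `g z + g (−z) = 2`, `g (−√(2/3)) = 2`: the WK no-go read through the definition.  The window is the content.

Numerics of this generation (kit j330789, memo HOME/wulff-p1/g20/CONFINED-CERT-g20.md) locate the windows `W` for
which an admissible profile exists.  WHAT THIS IS NOT: `ConfinedCodeBound W g` is proved for NO `W > 0` here; the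
crux and rung F-C1 not moved.
-/

noncomputable section

namespace Summit.Ventures.Crystal3D.Theorems

open Finset
open scoped InnerProductSpace

/-- **Windowed weighted-kissing bound** (NAMED SHAPE; a hypothesis to be supplied by a spherical-code
certificate, nothing is asserted): for every offset `a` and every finite `60°`-code `N` (unit vectors of `ℝ³`,
pairwise inner products `≤ 1/2`) each of whose members has third coordinate EITHER exactly `a − √(2/3)` (the
directions from a film ball to its substrate plugs) OR in the window `[a, a + W]` (the directions to its film
partners in a film confined to a height band of width `W`), the `g`-weight `Σ_{u ∈ N} g(u₂)` is at most `12`. -/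
def ConfinedCodeBound (W : ℝ) (g : ℝ → ℝ) : Prop :=
  ∀ a : ℝ, ∀ N : Finset (EuclideanSpace ℝ (Fin 3)), (∀ u ∈ N, ‖u‖ = 1) →
    (∀ u ∈ N, ∀ v ∈ N, u ≠ v → ⟪u, v⟫_ℝ ≤ 1 / 2) →
    (∀ u ∈ N, u 2 = a - Real.sqrt (2 / 3) ∨ (a ≤ u 2 ∧ u 2 ≤ a + W)) →
    ∑ u ∈ N, g (u 2) ≤ 12

/-- The windowed bound is antitone in the window width. -/
theorem ConfinedCodeBound.mono {W W' : ℝ} {g : ℝ → ℝ} (h : W' ≤ W) (hc : ConfinedCodeBound W g) :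
    ConfinedCodeBound W' g :=
  fun a N h1 h2 h3 => hc a N h1 h2 fun u hu => (h3 u hu).imp id fun hw => ⟨hw.1, hw.2.trans (by linarith)⟩

/-- The third coordinate is the `e₃`-height. -/
private theorem inner_e3_defs (v : EuclideanSpace ℝ (Fin 3)) :
    ⟪v, EuclideanSpace.single 2 (1 : ℝ)⟫_ℝ = v 2 := by
  rw [EuclideanSpace.inner_single_right]; simp

/-- **No confinement, no bound**: with the window `W = 2` (every direction allowed) the weighted-kissing bound
fails for EVERY antitone profile with `g z + g (−z) = 2` and `g (−√(2/3)) = 2` — this is the certified no-go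
`WKNoGo.weightedKissing_noGo_ten` (a ten-point `60°`-code of weight `> 12`) read through the definition. -/
theorem not_confinedCodeBound_two (g : ℝ → ℝ) (hg : Antitone g) (hsym : ∀ z, g z + g (-z) = 2)
    (h0 : g (-Real.sqrt (2 / 3)) = 2) : ¬ ConfinedCodeBound 2 g := by
  intro hc
  obtain ⟨F, hF1, hF2, -, hF⟩ := WKNoGo.weightedKissing_noGo_ten g hg hsym h0
  have hwin : ∀ u ∈ F, u 2 = -1 - Real.sqrt (2 / 3) ∨ (-1 ≤ u 2 ∧ u 2 ≤ -1 + 2) := by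
    intro u hu
    right
    have h := abs_real_inner_le_norm u (EuclideanSpace.single 2 (1 : ℝ))
    rw [inner_e3_defs, PiLp.norm_single, norm_one, mul_one, hF1 u hu, abs_le] at h
    constructor <;> linarith [h.1, h.2]
  exact absurd (hc (-1) F hF1 hF2 hwin) (not_le.2 hF)

/-! ## The physical offsets (appended, wulff-p1 g20): `a ∈ [−W, 0]` -/

/-- **Windowed weighted-kissing bound at the PHYSICAL offsets only.**  In a film over the close-packed layer `k`
confined below height `(k+1)√(2/3) + W`, a ball at height `h ∈ [(k+1)√(2/3), (k+1)√(2/3) + W]` has offset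
`a = (k+1)√(2/3) − h ∈ [−W, 0]`; the reduction only ever uses `ConfinedCodeBound` at such offsets.  This is the
same named shape with the offset restricted to `−W ≤ a ≤ 0` (so: implied by `ConfinedCodeBound W g`, and the
honest target of a certificate).  NAMED SHAPE; nothing asserted. -/
def ConfinedCodeBoundPhys (W : ℝ) (g : ℝ → ℝ) : Prop :=
  ∀ a : ℝ, -W ≤ a → a ≤ 0 → ∀ N : Finset (EuclideanSpace ℝ (Fin 3)), (∀ u ∈ N, ‖u‖ = 1) →
    (∀ u ∈ N, ∀ v ∈ N, u ≠ v → ⟪u, v⟫_ℝ ≤ 1 / 2) →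
    (∀ u ∈ N, u 2 = a - Real.sqrt (2 / 3) ∨ (a ≤ u 2 ∧ u 2 ≤ a + W)) →
    ∑ u ∈ N, g (u 2) ≤ 12

/-- The full-offset shape implies the physical-offset shape. -/
theorem ConfinedCodeBound.phys {W : ℝ} {g : ℝ → ℝ} (hc : ConfinedCodeBound W g) :
    ConfinedCodeBoundPhys W g :=
  fun a _ _ N h1 h2 h3 => hc a N h1 h2 h3

/-- The physical-offset shape is antitone in the window width. -/
theorem ConfinedCodeBoundPhys.mono {W W' : ℝ} {g : ℝ → ℝ} (h : W' ≤ W) (hc : ConfinedCodeBoundPhys W g) :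
    ConfinedCodeBoundPhys W' g :=
  fun a ha ha0 N h1 h2 h3 => hc a (by linarith) ha0 N h1 h2 fun u hu =>
    (h3 u hu).imp id fun hw => ⟨hw.1, hw.2.trans (by linarith)⟩

end Summit.Ventures.Crystal3D.Theorems

end
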